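import Literature.Topology.FourManifolds.TautFoliationsProductSpheres
import Literature.Topology.FourManifolds.SmoothOrientationProd
import Literature.Topology.FourManifolds.SPC4HandlesProofs
import Literature.AlgebraicTopology.FundamentalGroup.PuncturedPlane
import Literature.AlgebraicTopology.FundamentalGroup.SphereSimplyConnected
import Literature.AlgebraicTopology.SingularHomology.Hurewicz
import Mathlib.GroupTheory.SpecificGroups.Cyclic
import Mathlib.Analysis.InnerProductSpace.PiL2
import HarnessLib

/-!
# Novikov's theorem (leaves of taut foliations are `π₁`-injective) and Property R two levels down

Sibling of `TautFoliations.lean`, which reduced Gabai's Property R theorem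
(`Literature.Topology.FourManifolds.isUnknot_of_isIntegralSurgery_zero`: `0`-surgery on `K ⊆ S³` is `S² × S¹` only for
the unknot) to Gabai's Corollary 8.2, Seifert surfaces, "genus `0` iff unknot" and the ad hoc
consequence of Novikov's theorem on `S² × S¹` "every compact leaf of a transversely oriented taut
foliation of `S² × S¹` has genus `0`" (a corollary of Schultens (2014), Thm. 7.5.12 (iii) with
Lemma 7.5.14, the hypothesis `hN` of `Literature.Topology.FourManifolds.Knot.genus_eq_zero_of_isIntegralSurgery_zero_of_novikov`).
This file **proves** that consequence — stated in full as the conclusion of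
`Literature.Topology.FourManifolds.Foliation.genus_eq_zero_of_isTaut_sphereTwo_prod_sphereOne_of_novikov`, so that it need not be
carried as a named fact of its own — from Novikov's theorem proper (leaves of taut foliations are
`π₁`-injective, vendored as printed) and the Hurewicz theorem, by the argument: a compact leaf
`L ≅ Σ_g` injects
`π₁(Σ_g) ↪ π₁(S² × S¹) ≅ ℤ`, so `π₁(Σ_g)` is cyclic, so `H₁(Σ_g; ℤ) ≅ π₁(Σ_g)ᵃᵇ` is cyclic,
so `2g = rank H₁(Σ_g; ℤ) ≤ 1` and `g = 0`.

* `Literature.Topology.FourManifolds.Foliation.fundamentalGroup_map_injective_of_isTaut` (**named fact**, Novikov 1965; as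
  printed in Gabai, J. Differential Geom. 18 (1983), Thm. 2.8 (4): for a transversely oriented
  codimension-one foliation without Reeb components of a compact oriented 3-manifold, "for every
  leaf `L` in `𝓕` the map `π₁(L) → π₁(M)` is injective"; Schultens (2014), Thm. 7.5.12 (i) and
  Lemma 7.5.14 (taut foliations are Reebless); topological (`C⁰`) foliations: Solodov (1984),
  Bowden (2016), Def. 2.1, Thm. 2.2, Thm. 2.7): for a transversely oriented taut `C⁰` foliation of
  a closed connected oriented 3-manifold, the inclusion of a compact leaf induces injections of
  fundamental groups.
* `Literature.Topology.FourManifolds.Foliation.isCyclic_fundamentalGroup_cstar`, `…_sphereOne`,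
  `…_prod_of_simplyConnectedSpace`, `…_sphereTwo_prod_sphereOne` (**proved**): `π₁(ℂ ∖ 0)`,
  `π₁(S¹)`, `π₁(S × C)` for `S` simply connected and `π₁(C)` cyclic, and `π₁(S² × S¹)` are cyclic
  groups (Hatcher, Thm. 1.7, Prop. 1.12, Prop. 1.14; from
  `Literature.AlgebraicTopology.FundamentalGroup.PuncturedPlane.fromPath_mem_zpowers` — `π₁(ℂ ∖ 0)` is generated by the winding loop, via
  the covering `exp` — the retraction `ℂ ∖ 0 → S¹`, and `Literature.AlgebraicTopology.FundamentalGroup.simplyConnectedSpace_sphere`).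
* `Literature.Topology.FourManifolds.Foliation.fundamentalGroup_map_injective_productSpheres` (**proved**): the conclusion of
  Novikov's theorem holds for the product foliation of `S² × S¹` by spheres (the example of
  `TautFoliationsProductSpheres.lean` exhibiting its hypotheses): sphere leaves are simply
  connected.
* `Literature.Topology.FourManifolds.Foliation.genus_eq_zero_of_isTaut_sphereTwo_prod_sphereOne_of_novikov` (**proved**): every
  compact leaf of a transversely oriented taut `C⁰` foliation of `S² × S¹` has genus `0` (the
  statement spelled out in full), from Novikov's theorem, the Hurewicz theorem
  (`Literature.AlgebraicTopology.SingularHomology.singularHomology.hurewicz_one`, Hatcher Thm. 2A.1) and the orientability of `S² × S¹`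
  (`Literature.Topology.FourManifolds.isOrientable_sphere_prod_sphere`).
* `Literature.Topology.FourManifolds.isUnknot_of_isIntegralSurgery_zero_of_novikov_hurewicz` (**proved**): Property R from
  Novikov's theorem, the Hurewicz theorem, Gabai's Corollary 8.2, the existence of Seifert
  surfaces and "genus `0` iff unknot".

## References

* S. P. Novikov, *The topology of foliations*, Trudy Moskov. Mat. Obšč. 14 (1965) 248–278
  [Novikov1965].
* D. Gabai, *Foliations and the topology of 3-manifolds*, J. Differential Geom. 18 (1983)
  445–503, Thm. 2.8 (4), Def. 2.11 (p. 450) [Gabai1983].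
* J. Schultens, *Introduction to 3-Manifolds*, Grad. Stud. Math. 151, AMS (2014), Thm. 7.5.12
  (i), Def. 7.5.13, Lemma 7.5.14 (pp. 241–242) [Schultens2014].
* V. V. Solodov, *Components of topological foliations*, Mat. Sb. 119(161) (1982) 340–354; Math.
  USSR-Sb. 47 (1984) 329–343 [Solodov1984].
* J. Bowden, *Approximating `C⁰`-foliations by contact structures*, Geom. Funct. Anal. 26 (2016)
  1255–1296, Def. 2.1, Thm. 2.2 (Calegari), Thm. 2.7 (Novikov, Solodov) [Bowden2016].
* A. Hatcher, *Algebraic Topology*, CUP (2002), Thm. 1.7, Prop. 1.12, Prop. 1.14, Prop. 1.17,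
  Thm. 2A.1 [HatcherAT2002].
* D. Gabai, *Foliations and the topology of 3-manifolds. III*, J. Differential Geom. 26 (1987)
  479–536, Cor. 8.2, Cor. 8.3, Remark 8.5 [GabaiJDG1987].

## Design notes

* Novikov's theorem is vendored for *compact* leaves only: a compact leaf `F.leaf x ⊆ M` is
  closed, hence proper, and carries the topology induced from `M`, in which its fundamental
  group is taken (`FundamentalGroup ↥(F.leaf x) p`); for non-compact leaves the leaf topology
  (not defined in `TautFoliations.lean`) would be needed. The hypotheses are those printed —
  `M` a closed (compact, without boundary: `IM.Boundaryless`), connected, oriented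
  (`Literature.Topology.FourManifolds.IsOrientable`) 3-manifold, `F` transversely oriented — with "no Reeb components"
  strengthened to *taut* (`F.IsTaut`, every leaf meets a closed transversal), which implies it
  (Schultens (2014), Lemma 7.5.14; Gabai (1983), Def. 2.11).
* The product `S² × S¹` carries the product charts (model `(𝓡 2).prod (𝓡 1)` on `𝔼 2 × 𝔼 1`,
  of dimension `3`), as in `TautFoliations.lean`; it is orientable by
  `Literature.Topology.FourManifolds.isOrientable_sphere_prod_sphere` (`SmoothOrientationProd.lean`).
* Notation `𝔼 n`, `𝕊 n` is local, as in the sibling files.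
-/

open scoped Manifold ContDiff Topology
open Function Set

noncomputable section

universe u

namespace Literature.Topology.FourManifolds

/-- Local notation: `𝔼 n` is the model Euclidean space `EuclideanSpace ℝ (Fin n)`. -/
local notation "𝔼 " n:arg => EuclideanSpace ℝ (Fin n)

/-- Local notation: `𝕊 n` is the unit sphere in `EuclideanSpace ℝ (Fin (n + 1))`, the standard
`n`-sphere with its Mathlib manifold structure. -/
local notation "𝕊 " n:arg => (Metric.sphere (0 : EuclideanSpace ℝ (Fin (n + 1))) 1)

namespace Foliation

/-! ## `π₁(ℂ ∖ 0)`, `π₁(S¹)` and `π₁(S² × S¹)` are cyclic -/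

open Literature.AlgebraicTopology.FundamentalGroup.PuncturedPlane in
/-- **`π₁(ℂ ∖ 0, r)` is cyclic**: every class is a power of the class of the winding loop
(`Literature.AlgebraicTopology.FundamentalGroup.PuncturedPlane.fromPath_mem_zpowers`, Hatcher Thm. 1.7 via the covering `exp`).
[cite: HatcherAT2002, Thm. 1.7] -/
theorem isCyclic_fundamentalGroup_cstar (r : ℝ) (hr : 0 < r) :
    IsCyclic (FundamentalGroup CStar (bpt r hr)) := by
  refine ⟨⟨FundamentalGroup.fromPath (Path.Homotopic.Quotient.mk (windingLoop r hr 1)),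
    fun a ↦ ?_⟩⟩
  obtain ⟨β, hβ⟩ := Path.Homotopic.Quotient.mk_surjective (FundamentalGroup.toPath a)
  rw [show a = FundamentalGroup.fromPath (Path.Homotopic.Quotient.mk β) from hβ.symm]
  exact fromPath_mem_zpowers r hr β

/-- Points of the circle `𝕊¹ ⊆ ℝ²` are nonzero complex numbers under Mathlib's isometry
`ℝ² ≃ ℂ` (`Complex.orthonormalBasisOneI`). [folklore] -/
theorem orthonormalBasisOneI_symm_ne_zero (u : 𝕊 1) :
    Complex.orthonormalBasisOneI.repr.symm (u : 𝔼 2) ≠ 0 := by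
  rw [← norm_ne_zero_iff, LinearIsometryEquiv.norm_map, norm_eq_of_mem_sphere u]
  exact one_ne_zero

/-- The circle `𝕊¹ ⊆ ℝ²` inside the punctured plane `ℂ ∖ 0`, through Mathlib's isometry
`ℝ² ≃ ℂ` (`Complex.orthonormalBasisOneI`). [folklore] -/
def circleToCStar : C(𝕊 1, Literature.AlgebraicTopology.FundamentalGroup.PuncturedPlane.CStar) where
  toFun u := ⟨Complex.orthonormalBasisOneI.repr.symm (u : 𝔼 2), orthonormalBasisOneI_symm_ne_zero u⟩
  continuous_toFun :=
    (Complex.orthonormalBasisOneI.repr.symm.continuous.comp continuous_subtype_val).subtype_mk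
      orthonormalBasisOneI_symm_ne_zero

/-- Value of `circleToCStar`. [folklore] -/
@[simp] theorem circleToCStar_apply_coe (u : 𝕊 1) :
    (circleToCStar u : ℂ) = Complex.orthonormalBasisOneI.repr.symm (u : 𝔼 2) := rfl

/-- The radial retraction `ℂ ∖ 0 → 𝕊¹`, `z ↦ z / ‖z‖` read in `ℝ² ≃ ℂ`. [folklore] -/
def cstarToCircle : C(Literature.AlgebraicTopology.FundamentalGroup.PuncturedPlane.CStar, 𝕊 1) where
  toFun z := ⟨Complex.orthonormalBasisOneI.repr (‖(z : ℂ)‖⁻¹ • (z : ℂ)), by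
    rw [mem_sphere_zero_iff_norm, LinearIsometryEquiv.norm_map, norm_smul, norm_inv, norm_norm,
      inv_mul_cancel₀ (norm_ne_zero_iff.mpr z.2)]⟩
  continuous_toFun := by
    refine (Complex.orthonormalBasisOneI.repr.continuous.comp ?_).subtype_mk _
    exact ((continuous_subtype_val.norm).inv₀ fun z ↦ norm_ne_zero_iff.mpr z.2).smul
      continuous_subtype_val

/-- Value of `cstarToCircle`. [folklore] -/
@[simp] theorem cstarToCircle_apply_coe (z : Literature.AlgebraicTopology.FundamentalGroup.PuncturedPlane.CStar) :
    ((cstarToCircle z : 𝕊 1) : 𝔼 2) =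
      Complex.orthonormalBasisOneI.repr (‖(z : ℂ)‖⁻¹ • (z : ℂ)) := rfl

/-- The radial retraction is a left inverse of the inclusion of the circle. [folklore] -/
theorem cstarToCircle_circleToCStar (u : 𝕊 1) : cstarToCircle (circleToCStar u) = u := by
  apply Subtype.ext
  rw [cstarToCircle_apply_coe, circleToCStar_apply_coe, LinearIsometryEquiv.norm_map,
    norm_eq_of_mem_sphere u, inv_one, one_smul, LinearIsometryEquiv.apply_symm_apply]

/-- The base point `(1, 0)` of `𝕊¹`, corresponding to `1 ∈ ℂ ∖ 0`. [folklore] -/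
def circleBase : 𝕊 1 := cstarToCircle (Literature.AlgebraicTopology.FundamentalGroup.PuncturedPlane.bpt 1 one_pos)

/-- `circleToCStar` maps the base point of `𝕊¹` to the base point `1` of `ℂ ∖ 0`. [folklore] -/
theorem circleToCStar_circleBase : circleToCStar circleBase = Literature.AlgebraicTopology.FundamentalGroup.PuncturedPlane.bpt 1 one_pos := by
  apply Subtype.ext
  rw [circleToCStar_apply_coe, circleBase, cstarToCircle_apply_coe,
    LinearIsometryEquiv.symm_apply_apply, Literature.AlgebraicTopology.FundamentalGroup.PuncturedPlane.bpt_coe]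
  simp

/-- **`π₁(S¹)` is cyclic** (Hatcher, Thm. 1.7: `π₁(S¹) ≅ ℤ`; here: cyclic), at every base point:
the inclusion `𝕊¹ ↪ ℂ ∖ 0` has the radial retraction as a left inverse, so it induces an
injection `π₁(𝕊¹) ↪ π₁(ℂ ∖ 0)` (Hatcher, Prop. 1.17) into a cyclic group
(`isCyclic_fundamentalGroup_cstar`); the base point is moved along a path (`𝕊¹` is path
connected). [cite: HatcherAT2002, Thm. 1.7 and Prop. 1.17] -/
theorem isCyclic_fundamentalGroup_sphereOne (u : 𝕊 1) : IsCyclic (FundamentalGroup (𝕊 1) u) := by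
  haveI : PathConnectedSpace (𝕊 1) := by
    refine isPathConnected_iff_pathConnectedSpace.mp (isPathConnected_sphere ?_ _ zero_le_one)
    rw [← Module.finrank_eq_rank, finrank_euclideanSpace, Fintype.card_fin]
    norm_num
  haveI := isCyclic_fundamentalGroup_cstar 1 one_pos
  have key : ∀ a : FundamentalGroup (𝕊 1) circleBase,
      FundamentalGroup.mapOfEq cstarToCircle
          (rfl : cstarToCircle (Literature.AlgebraicTopology.FundamentalGroup.PuncturedPlane.bpt 1 one_pos) = circleBase)
        (FundamentalGroup.mapOfEq circleToCStar circleToCStar_circleBase a) = a := fun a ↦ by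
    rw [← FundamentalGroup.mapOfEq_comp_apply circleToCStar cstarToCircle
      circleToCStar_circleBase rfl a]
    exact FundamentalGroup.mapOfEq_apply_eq_self_of_forall_eq (cstarToCircle.comp circleToCStar)
      (fun v ↦ cstarToCircle_circleToCStar v) a
  have hinj : Injective (FundamentalGroup.mapOfEq circleToCStar circleToCStar_circleBase) := by
    intro a b hab
    rw [← key a, ← key b, hab]
  haveI : IsCyclic (FundamentalGroup (𝕊 1) circleBase) := isCyclic_of_injective _ hinj
  exact isCyclic_of_surjective _
    (FundamentalGroup.fundamentalGroupMulEquivOfPathConnected circleBase u).surjective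

/-- **`π₁(S × C)` is cyclic if `S` is simply connected and `π₁(C)` is cyclic**: every class of
a loop of `S × C` at `(s₀, c)` is the image under the slice inclusion `x ↦ (s₀, x)` of the class
of its projection to `C` (`Literature.AlgebraicTopology.FundamentalGroup.PuncturedPlane.fromPath_eq_map_slice`; Hatcher Prop. 1.12,
`π₁(X × Y) ≅ π₁(X) × π₁(Y)`). [cite: HatcherAT2002, Prop. 1.12] -/
theorem isCyclic_fundamentalGroup_prod_of_simplyConnectedSpace {S C : Type*} [TopologicalSpace S]
    [TopologicalSpace C] [SimplyConnectedSpace S] (s₀ : S) (c : C)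
    [IsCyclic (FundamentalGroup C c)] : IsCyclic (FundamentalGroup (S × C) (s₀, c)) := by
  refine isCyclic_of_surjective
    (FundamentalGroup.map (⟨fun x ↦ (s₀, x), by fun_prop⟩ : C(C, S × C)) c) fun a ↦ ?_
  obtain ⟨β, hβ⟩ := Path.Homotopic.Quotient.mk_surjective (FundamentalGroup.toPath a)
  refine ⟨FundamentalGroup.fromPath (Path.Homotopic.Quotient.mk (β.map continuous_snd)), ?_⟩
  rw [show a = FundamentalGroup.fromPath (Path.Homotopic.Quotient.mk β) from hβ.symm]
  exact (Literature.AlgebraicTopology.FundamentalGroup.PuncturedPlane.fromPath_eq_map_slice s₀ c β).symm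

/-- **`π₁(S² × S¹)` is cyclic** (it is `π₁(S²) × π₁(S¹) ≅ 1 × ℤ`, Hatcher Prop. 1.12,
Prop. 1.14, Thm. 1.7), at every base point: `S²` is simply connected
(`Literature.AlgebraicTopology.FundamentalGroup.simplyConnectedSpace_euclideanSphere`) and `π₁(S¹)` is cyclic.
[cite: HatcherAT2002, Prop. 1.12 and Prop. 1.14] -/
theorem isCyclic_fundamentalGroup_sphereTwo_prod_sphereOne (p : (𝕊 2) × (𝕊 1)) :
    IsCyclic (FundamentalGroup ((𝕊 2) × (𝕊 1)) p) := by
  haveI : SimplyConnectedSpace (𝕊 2) := Literature.AlgebraicTopology.FundamentalGroup.simplyConnectedSpace_euclideanSphere 2 le_rfl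
  haveI := isCyclic_fundamentalGroup_sphereOne p.2
  obtain ⟨a, b⟩ := p
  exact isCyclic_fundamentalGroup_prod_of_simplyConnectedSpace a b

/-! ## Novikov's theorem, as a named fact -/

/-- **Novikov's theorem: leaves of taut foliations are `π₁`-injective** (named fact, D-0014).
S. P. Novikov, *The topology of foliations*, Trudy Moskov. Mat. Obšč. 14 (1965), in the printed
form of Gabai, J. Differential Geom. 18 (1983), Thm. 2.8 (4), p. 450: for `M` a compact oriented
3-manifold and `𝓕` a transversely oriented codimension-one foliation of `M` without Reeb
components, transverse to `∂M`, "for every leaf `L` in `𝓕` the map `π₁(L) → π₁(M)` is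
injective" (also Schultens, *Introduction to 3-Manifolds* (2014), Thm. 7.5.12 (i): leaves of a
Reebless foliation of a closed orientable 3-manifold are incompressible). For topological
(`C⁰`) foliations — `Literature.Topology.FourManifolds.Foliation`: a `C⁰` atlas whose transition maps preserve the plaques,
which is Bowden, Geom. Funct. Anal. 26 (2016), Def. 2.1 — the theorem is due to Solodov, Mat. Sb.
119 (1982) (Bowden (2016), Thm. 2.7 "(Novikov, Solodov)": for a Reebless `C⁰`-foliation "the
inclusion of any leaf `L ↪ M` is `π₁`-injective", together with Calegari's straightening
theorem, ibid. Thm. 2.2, that a topological foliation by surfaces of a 3-manifold is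
topologically isotopic to a leafwise smooth one). **Vendored**, for closed manifolds and compact
leaves: for `M` a compact connected oriented (`Literature.Topology.FourManifolds.IsOrientable`) 3-manifold without boundary
(any boundaryless model `IM` on a `3`-dimensional space) and `F` a transversely oriented *taut*
`C⁰` codimension-one foliation of `M` — taut (every leaf meets a closed transversal,
`F.IsTaut`) implies "without Reeb components" (Schultens (2014), Lemma 7.5.14; Gabai (1983),
Def. 2.11) — and for every *compact* leaf `L = F.leaf x` (a closed, hence proper, leaf, whose
leaf topology is the topology induced from `M`) and every base point `p ∈ L`, the homomorphism
`π₁(L, p) → π₁(M, p)` induced by the inclusion is injective. Not available in Mathlib or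
`Literature/` (no foliation theory). [cite: Gabai1983, Thm. 2.8 (4); Schultens2014, Thm. 7.5.12 (i)
and Lemma 7.5.14; Bowden2016, Thm. 2.7] -/
def fundamentalGroup_map_injective_of_isTaut : Prop :=
  ∀ {EM HM : Type} [NormedAddCommGroup EM] [NormedSpace ℝ EM] [FiniteDimensional ℝ EM]
    [TopologicalSpace HM] (IM : ModelWithCorners ℝ EM HM) [IM.Boundaryless]
    (_hdim : Module.finrank ℝ EM = 3)
    (M : Type u) [TopologicalSpace M] [T2Space M] [SecondCountableTopology M] [CompactSpace M]
    [ConnectedSpace M] [ChartedSpace HM M] [IsManifold IM ∞ M] (_hM : IsOrientable IM M)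
    (F : Foliation (𝔼 2) M) (_ho : F.IsTransverselyOriented) (_ht : F.IsTaut)
    (x : M) (_hx : IsCompact (F.leaf x)) (p : F.leaf x),
    Injective (FundamentalGroup.map (⟨Subtype.val, continuous_subtype_val⟩ : C(F.leaf x, M)) p)

/-- **The model example satisfies Novikov's conclusion** (a check of the statement on the
foliation exhibiting its hypotheses): the product foliation of `S² × S¹` by spheres is
transversely oriented and taut with compact leaves
(`productSpheres_isTransverselyOriented_isTaut_hasCompactLeafOfGenus_zero`), and its leaves, the
spheres `S² × {θ}` (`leaf_productSpheres`), are simply connected (Hatcher, Prop. 1.14), so the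
inclusion-induced homomorphisms `π₁(S² × {θ}, p) → π₁(S² × S¹, p)` are injective. [folklore] -/
theorem fundamentalGroup_map_injective_productSpheres (x : (𝕊 2) × (𝕊 1))
    (p : productSpheres.leaf x) :
    Injective (FundamentalGroup.map
      (⟨Subtype.val, continuous_subtype_val⟩ : C(productSpheres.leaf x, (𝕊 2) × (𝕊 1))) p) := by
  haveI : SimplyConnectedSpace (𝕊 2) := Literature.AlgebraicTopology.FundamentalGroup.simplyConnectedSpace_euclideanSphere 2 le_rfl
  -- the leaf is the slice `S² × {x.2}`, homeomorphic to `S²`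
  have hleaf : productSpheres.leaf x = Set.range (fun q : 𝕊 2 ↦ (q, x.2)) := by
    rw [leaf_productSpheres]
    ext y
    simp only [mem_setOf_eq, mem_range]
    exact ⟨fun h ↦ ⟨y.1, Prod.ext rfl h.symm⟩, fun ⟨q, hq⟩ ↦ hq ▸ rfl⟩
  have hemb : Topology.IsClosedEmbedding (fun q : 𝕊 2 ↦ (q, x.2)) :=
    (continuous_id.prodMk continuous_const).isClosedEmbedding fun a b h ↦ congrArg Prod.fst h
  let ψ : (𝕊 2) ≃ₜ productSpheres.leaf x :=
    hemb.isEmbedding.toHomeomorph.trans (Homeomorph.setCongr hleaf.symm)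
  haveI : SimplyConnectedSpace (productSpheres.leaf x) :=
    ψ.symm.toHomotopyEquiv.simplyConnectedSpace
  exact fun a b _ ↦ Subsingleton.elim a b

/-! ## The genus-`0` consequence on `S² × S¹`, proved -/

/-- **Every compact leaf of a transversely oriented taut foliation of `S² × S¹` has genus `0`**
(Novikov's theorem on `S² × S¹` in consequence form: by Schultens (2014), Thm. 7.5.12 (iii) and
Lemma 7.5.14 — Gabai (1983), Thm. 2.8 (3) — such a foliation is the product foliation by spheres;
the statement is spelled out in full: for every transversely oriented taut `C⁰` foliation `F` of
`↥(𝕊 2) × ↥(𝕊 1)` and every `g`, `F.HasCompactLeafOfGenus g → g = 0`), **proved** from Novikov's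
theorem (`fundamentalGroup_map_injective_of_isTaut`, Thm. 2.8 (4)) and the Hurewicz theorem
(`Literature.AlgebraicTopology.SingularHomology.singularHomology.hurewicz_one`): let the compact leaf `L = F.leaf x` be
homeomorphic to the closed connected orientable surface `S` with `rank H₁(S; ℤ) = 2g`. `S² × S¹`
is a closed connected oriented 3-manifold (`Literature.Topology.FourManifolds.isOrientable_sphere_prod_sphere`), so by Novikov
`π₁(L, p) → π₁(S² × S¹, p)` is injective; `π₁(S² × S¹)` is cyclic
(`isCyclic_fundamentalGroup_sphereTwo_prod_sphereOne`), hence so are `π₁(L, p)` and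
`π₁(S, s₀) ≅ π₁(L, φ s₀)`; by Hurewicz `H₁(S; ℤ)` is then cyclic, `2g = rank H₁(S; ℤ) ≤ 1`
(`Literature.AlgebraicTopology.SingularHomology.singularHomology.finrank_one_le_one_of_isCyclic`), so `g = 0`. (This replaces the appeal
to Reeb stability in the classical proof that such a foliation is the product foliation.)
[cite: Gabai1983, Thm. 2.8 (4); HatcherAT2002, Thm. 2A.1] -/
theorem genus_eq_zero_of_isTaut_sphereTwo_prod_sphereOne_of_novikov
    (hN : fundamentalGroup_map_injective_of_isTaut.{0}) (hH : Literature.AlgebraicTopology.SingularHomology.singularHomology.hurewicz_one.{0}) :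
    ∀ F : Foliation (𝔼 2) ((𝕊 2) × (𝕊 1)), F.IsTransverselyOriented → F.IsTaut →
      ∀ g : ℕ, F.HasCompactLeafOfGenus g → g = 0 := by
  intro F ho ht g hg
  obtain ⟨x, hx, S, _, _, _, _, _, _, _, _, hrank, ⟨φ⟩⟩ := hg
  -- `S² × S¹` is a closed connected oriented 3-manifold
  haveI : ConnectedSpace (𝕊 2) := connectedSpace_sphereTwo
  haveI : PathConnectedSpace (𝕊 1) := by
    refine isPathConnected_iff_pathConnectedSpace.mp (isPathConnected_sphere ?_ _ zero_le_one)
    rw [← Module.finrank_eq_rank, finrank_euclideanSpace, Fintype.card_fin]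
    norm_num
  have hdim : Module.finrank ℝ ((𝔼 2) × (𝔼 1)) = 3 := by simp
  -- a base point on the leaf, read on the abstract surface `S`
  haveI : LocallyPathConnectedSpace S := ChartedSpace.locallyPathConnectedSpace (𝔼 2) S
  haveI : PathConnectedSpace S := pathConnectedSpace_iff_connectedSpace.mpr inferInstance
  obtain ⟨s₀⟩ := (inferInstance : Nonempty S)
  -- Novikov: `π₁(L, φ s₀) ↪ π₁(S² × S¹)`, a cyclic group
  have hinj := hN ((𝓡 2).prod (𝓡 1)) hdim ((𝕊 2) × (𝕊 1)) (isOrientable_sphere_prod_sphere 2 1)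
    F ho ht x hx (φ s₀)
  haveI := isCyclic_fundamentalGroup_sphereTwo_prod_sphereOne ((φ s₀ : F.leaf x) : (𝕊 2) × (𝕊 1))
  haveI : IsCyclic (FundamentalGroup (F.leaf x) (φ s₀)) := isCyclic_of_injective _ hinj
  haveI : IsCyclic (FundamentalGroup S s₀) :=
    isCyclic_of_injective (Homeomorph.fundamentalGroupCongr φ rfl).toMonoidHom
      (Homeomorph.fundamentalGroupCongr φ rfl).injective
  -- Hurewicz: `rank H₁(S; ℤ) ≤ 1`
  have hle := Literature.AlgebraicTopology.SingularHomology.singularHomology.finrank_one_le_one_of_isCyclic hH s₀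
  omega

end Foliation

section SPC4

variable [SphereEmbedding.SmoothnessFacts] in
/-- **Property R along its printed proof, two levels below Corollary 8.3** (proved reduction of
`spc4.S25`): Novikov's theorem (`Foliation.fundamentalGroup_map_injective_of_isTaut`), the
Hurewicz theorem (`singularHomology.hurewicz_one`), Gabai's Corollary 8.2
(`Knot.exists_isTaut_hasCompactLeafOfGenus_of_isIntegralSurgery_zero`), the existence of Seifert
surfaces (`Knot.exists_hasSeifertSurfaceOfGenus`, Seifert 1934) and "genus `0` iff unknot"
(`Knot.genus_eq_zero_iff_isUnknot`) give `isUnknot_of_isIntegralSurgery_zero`: if `S² × S¹` is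
`0`-surgery on `K` then `K` is the unknot. [cite: GabaiJDG1987, Cor. 8.2, Cor. 8.3 and Remark 8.5] -/
theorem isUnknot_of_isIntegralSurgery_zero_of_novikov_hurewicz
    (hN : Foliation.fundamentalGroup_map_injective_of_isTaut.{0})
    (hH : Literature.AlgebraicTopology.SingularHomology.singularHomology.hurewicz_one.{0})
    (h82 : Knot.exists_isTaut_hasCompactLeafOfGenus_of_isIntegralSurgery_zero.{0})
    (hS : Knot.exists_hasSeifertSurfaceOfGenus) (hD : Knot.genus_eq_zero_iff_isUnknot) :
    isUnknot_of_isIntegralSurgery_zero :=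
  isUnknot_of_isIntegralSurgery_zero_of_novikov
    (Foliation.genus_eq_zero_of_isTaut_sphereTwo_prod_sphereOne_of_novikov hN hH) h82 hS hD

end SPC4

end Literature.Topology.FourManifolds
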